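import Literature.MathematicalPhysics.QuantumFieldTheory.FiniteTemperatureOSForms
import Literature.MathematicalPhysics.QuantumFieldTheory.FiniteTemperatureTimeTranslations
import Literature.Barriers.QuantumFields.FiniteTemperatureSpatialReflectionBlocks
import HarnessLib

/-!
# Tomboulis–Yaffe at finite temperature, I: Wilson rectangles against Polyakov-loop correlators on the
# Borgs–Seiler lattice `ℤ_{L_t} × (ℤ/L_s)^d` (TY 1985 App. I (A1.3)–(A1.7), native setting `L_t ≠ L_s`)

E. T. Tomboulis and L. G. Yaffe, *Finite temperature SU(2) lattice gauge theory*, Commun. Math. Phys. **100** (1985)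
313–341, Appendix I ("Confinement criteria inequalities"), derive from reflection positivity in lattice hyperplanes the chain

  `W_{I,J} ≤ W_{2I,J}^{1/2}` (A1.3),   `W_{L_t/2,J} ≤ 2 G_J^{1/2}` (A1.6)–(A1.7),   `G_J ≤ G_{2J}^{1/2}` (§B),

between rectangular Wilson loops `W_{I,J}` in a (time, space) plane, the Polyakov-loop two-point function `G_J` (loops winding
around the TIME circle, separated by `J` in space) and (A1.8) the electric-flux free energy.  The tree has this chain on the
SYMMETRIC torus `(ℤ/Lℤ)^d` (`TomboulisYaffeLoopBounds.lean`, `…TwistBound.lean`, `…Inequality.lean`, whose docstring records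
"TODO(general form): asymmetric tori `L_t × L_s^{d-1}` need the tree's site reflection positivity for unequal sides").  This
file proves the first three links in TY's own FINITE-TEMPERATURE setting, on Borgs–Seiler's lattice
`FiniteTemperature.Config d L_t L_s G` (`Literature/Barriers/QuantumFields/FiniteTemperature*`), for every compact `G`,
continuous unitary `ρ`, ANY real `J_E, J_M`, using the Osterwalder–Schrader forms of `FiniteTemperatureOSForms.lean`
(time-site reflection for (A1.3), (A1.6); space-site reflection for §B):

* `timeStaple`, `timeRect` — the open three-sided path and the `h × 1` Wilson rectangle in the `(time, i)` plane based at
  `(t, x)`; `trace_rep_timeRect_eq_sum` (`tr W = Σ_{ab} ρ(staple)_{ab} conj ρ(U_{(t,x),i})_{ab}`), `timeStaple_timeReflect`,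
  `trace_rep_timeRect_two_mul` (the doubled rectangle based at `-h` is `tr(ρ(staple U) ρ(staple θU)ᴴ)`), `timeRect_timeTranslate`;
* ★ `normSq_integral_trace_timeRect_le` — (A1.3), un-normalised: for `1 ≤ h ≤ L_t/2` (`L_t = 2m + 2`),
  `|∫ tr ρ(W_{h×1}) e^{-S}|² ≤ N · Z · Re ∫ tr ρ(W_{2h×1}) e^{-S}`, and `0 ≤ Re ∫ tr ρ(W_{2h×1}) e^{-S}`;
* ★ `normSq_integral_trace_timeRect_half_le` — (A1.6)–(A1.7): `|∫ tr ρ(W_{(L_t/2)×1}) e^{-S}|² ≤ N² · Z · Re ∫ tr ρ(P_x) conj tr ρ(P_{x+e_i}) e^{-S}`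
  ("we may consider the spacelike legs of our loop to be on the opposite side of the planes of reflection from the timelike
  legs … Applying the Schwarz inequality for sums");
* ★ `normSq_integral_polyakov_pair_le` — §B, correlator doubling along the spatial axis `i` (`L_s = 2n + 2 ≥ 4`): for `x_i = 0`
  and `1 ≤ s ≤ n + 1`, `|∫ tr ρ(P_x) conj tr ρ(P_{x - s e_i}) e^{-S}|² ≤ N² · Z · Re ∫ tr ρ(P_{x + s e_i}) conj tr ρ(P_{x - s e_i}) e^{-S}`.

Everything is proved.  HONEST FRAMING: finite-volume inequalities at fixed couplings (no sign of `β` needed); the last link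
(A1.8) and the assembled inequality are in the sequel; nothing here is a statement about confinement or a mass gap.

References: E. T. Tomboulis, L. G. Yaffe, Commun. Math. Phys. 100 (1985) 313–341, §II (2.4)–(2.7), App. I (A1.1)–(A1.7), §B
[TomboulisYaffe1985]; E. Seiler, LNP 159 (1982) Ch. 2; C. Borgs, E. Seiler, Commun. Math. Phys. 91 (1983) 329, §II.2.
-/

noncomputable section

open MeasureTheory Filter Topology Finset
open scoped ComplexConjugate ComplexOrder BigOperators

namespace Literature.Barriers.QuantumFields

namespace FiniteTemperature

open Literature.MathematicalPhysics.QuantumFieldTheory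

/-! ### Wilson rectangles in a (time, space) plane: algebra -/

section Rect

variable {d L₀ L : ℕ} {G : Type*} [Group G] {N : ℕ}

/-- **The time-like staple**: from `(t, x)` up `h` time steps, across the spatial link `+e_i` at time `t + h`, and down to
`(t, x + e_i)` — an open three-sided path, as a group element. [cite: TomboulisYaffe1985, App. I (A1.1)–(A1.3)] -/
def timeStaple (U : Config d L₀ L G) (h : ℕ) (i : Fin d) (t : ZMod L₀) (x : Fin d → ZMod L) : G :=
  timeHolonomy U h (t, x) * U ((t + h, x), some i) * (timeHolonomy U h (t, x + Pi.single i 1))⁻¹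

/-- **The `h × 1` Wilson rectangle** in the `(time, i)` plane based at `(t, x)`: the staple closed by the spatial link
`((t, x), i)` traversed backwards (TY's `W_{I,J}` with `I = h`, `J = 1`). [cite: TomboulisYaffe1985, App. I (A1.1)] -/
def timeRect (U : Config d L₀ L G) (h : ℕ) (i : Fin d) (t : ZMod L₀) (x : Fin d → ZMod L) : G :=
  timeStaple U h i t x * (U ((t, x), some i))⁻¹

variable (ρ : G →* Matrix (Fin N) (Fin N) ℂ)

/-- `tr(M Dᴴ) = Σ_{a,b} M_{ab} conj D_{ab}` (the Hilbert–Schmidt pairing). [cite: TomboulisYaffe1985, §II.A eq. (2.5) (p. 315)] -/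
theorem trace_mul_star_eq_sum (M D : Matrix (Fin N) (Fin N) ℂ) :
    (M * star D).trace = ∑ a, ∑ b, M a b * conj (D a b) := by
  rw [Matrix.trace_mul_comm, trace_star_mul_eq_sum]
  exact Finset.sum_congr rfl fun a _ => Finset.sum_congr rfl fun b _ => mul_comm _ _

/-- **The traced rectangle as a pairing of the staple with its closing link** (unitary `ρ`):
`tr ρ(W_{h×1}) = Σ_{ab} ρ(staple)_{ab} conj ρ(U_{(t,x),i})_{ab}`. [cite: TomboulisYaffe1985, App. I (A1.1)–(A1.3)] -/
theorem trace_rep_timeRect_eq_sum (hρu : ∀ g, ρ g ∈ Matrix.unitaryGroup (Fin N) ℂ) (U : Config d L₀ L G) (h : ℕ)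
    (i : Fin d) (t : ZMod L₀) (x : Fin d → ZMod L) :
    (ρ (timeRect U h i t x)).trace = ∑ a, ∑ b, ρ (timeStaple U h i t x) a b * conj (ρ (U ((t, x), some i)) a b) := by
  rw [timeRect, map_mul, rep_inv_eq_star ρ hρu, trace_mul_star_eq_sum]

/-- **The staple read through the time reflection**: `staple(θU)` based at time `0` is the inverse three-sided path below the
plane, `(H_{[-h,0]}(x))⁻¹ · U_{(-h,x),i} · H_{[-h,0]}(x + e_i)`. [cite: TomboulisYaffe1985, App. I (A1.2)–(A1.3)] -/
theorem timeStaple_timeReflect (U : Config d L₀ L G) (h : ℕ) (i : Fin d) (x : Fin d → ZMod L) :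
    timeStaple (timeReflect U) h i 0 x =
      (timeHolonomy U h (-(h : ZMod L₀), x))⁻¹ * U ((-(h : ZMod L₀), x), some i) *
        timeHolonomy U h (-(h : ZMod L₀), x + Pi.single i 1) := by
  unfold timeStaple
  rw [timeHolonomy_timeReflect, timeHolonomy_timeReflect, inv_inv, zero_add, timeReflect_some, neg_zero, zero_sub]

/-- **The doubled rectangle** `W_{2h×1}` based at `(-h, x)` is the staple above the plane `t = 0` followed by the inverse of the
reflected staple, up to conjugation: `tr ρ(W_{2h×1}) = tr(ρ(staple U) ρ(staple θU)ᴴ) = Σ_{ab} ρ(staple U)_{ab} conj ρ(staple θU)_{ab}`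
(unitary `ρ`). [cite: TomboulisYaffe1985, App. I (A1.2)–(A1.3)] -/
theorem trace_rep_timeRect_two_mul (hρu : ∀ g, ρ g ∈ Matrix.unitaryGroup (Fin N) ℂ) (U : Config d L₀ L G) (h : ℕ)
    (i : Fin d) (x : Fin d → ZMod L) :
    (ρ (timeRect U (2 * h) i (-(h : ZMod L₀)) x)).trace =
      ∑ a, ∑ b, ρ (timeStaple U h i 0 x) a b * conj (ρ (timeStaple (timeReflect U) h i 0 x) a b) := by
  rw [← trace_mul_star_eq_sum, ← rep_inv_eq_star ρ hρu, ← map_mul, timeStaple_timeReflect]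
  -- the two closed paths are conjugate in `G`
  have hsplit : ∀ y : Fin d → ZMod L, timeHolonomy U (2 * h) (-(h : ZMod L₀), y) =
      timeHolonomy U h (-(h : ZMod L₀), y) * timeHolonomy U h (0, y) := by
    intro y
    rw [two_mul, timeHolonomy_add, neg_add_cancel]
  have hconj : timeRect U (2 * h) i (-(h : ZMod L₀)) x =
      timeHolonomy U h (-(h : ZMod L₀), x) *
        (timeStaple U h i 0 x * ((timeHolonomy U h (-(h : ZMod L₀), x))⁻¹ * U ((-(h : ZMod L₀), x), some i) *
          timeHolonomy U h (-(h : ZMod L₀), x + Pi.single i 1))⁻¹) *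
        (timeHolonomy U h (-(h : ZMod L₀), x))⁻¹ := by
    unfold timeRect timeStaple
    rw [hsplit x, hsplit (x + Pi.single i 1)]
    have e1 : (-(h : ZMod L₀) + ((2 * h : ℕ) : ZMod L₀)) = 0 + (h : ZMod L₀) := by push_cast; ring
    rw [e1]
    simp only [mul_inv_rev, inv_inv, mul_assoc, mul_inv_cancel, mul_one]
  rw [hconj, map_mul, map_mul, Matrix.trace_mul_cycle, ← map_mul, inv_mul_cancel, map_one, one_mul]

/-- Rectangles of a time-translated configuration are time-translated rectangles. [cite: TomboulisYaffe1985, App. I (A1.3)] -/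
theorem timeRect_timeTranslate (a : ZMod L₀) (U : Config d L₀ L G) (h : ℕ) (i : Fin d) (t : ZMod L₀)
    (x : Fin d → ZMod L) : timeRect (timeTranslate a U) h i t x = timeRect U h i (t + a) x := by
  unfold timeRect timeStaple
  rw [timeHolonomy_timeTranslate, timeHolonomy_timeTranslate, timeTranslate_apply, timeTranslate_apply]
  simp only [add_right_comm]

/-- The Polyakov loop at any spatial site splits at the half period (even `L₀ = 2n + 2`):
`g_{L_y} = H_{[0,n+1]}(y) · H_{[n+1,2n+2]}(y)`. [cite: BorgsSeiler1983, §II.3 Lemma II.4 (p. 336)] -/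
theorem polyakovLine_eq_mul_half {n : ℕ} (V : Config d (2 * n + 2) L G) (y : Fin d → ZMod L) :
    polyakovLine V y = timeHolonomy V (n + 1) (0, y) *
      timeHolonomy V (n + 1) ((((n + 1 : ℕ) : ZMod (2 * n + 2))), y) := by
  unfold polyakovLine
  have h : timeHolonomy V (2 * n + 2) ((0 : ZMod (2 * n + 2)), y) = timeHolonomy V ((n + 1) + (n + 1)) (0, y) := by
    congr 1; ring
  rw [h, timeHolonomy_add, zero_add]

end Rect

/-! ### (A1.3): doubling a rectangle in the time direction -/

section Doubling

variable {d m L : ℕ} [NeZero L] {G : Type*} [Group G] [TopologicalSpace G] [IsTopologicalGroup G]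
  [CompactSpace G] [MeasurableSpace G] [BorelSpace G] [SecondCountableTopology G] {N : ℕ}
variable (ρ : G →* Matrix (Fin N) (Fin N) ℂ)

omit [TopologicalSpace G] [IsTopologicalGroup G] [CompactSpace G] [MeasurableSpace G] [BorelSpace G]
  [SecondCountableTopology G] in
/-- The staple above the plane `t = 0` of height `h ≤ m + 1` depends only on the closed positive half. [cite: TomboulisYaffe1985, App. I (A1.3)] -/
theorem dependsOn_timeStaple {h : ℕ} (hh : h ≤ m + 1) (i : Fin d) (x : Fin d → ZMod L) :
    DependsOn (fun U : Config d (2 * m + 2) L G => timeStaple U h i 0 x)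
      ((evenPos d m L ∪ ∅ ∪ evenShared d m L : Finset _) : Set _) := by
  intro U V hUV
  simp only [timeStaple]
  have ht : ∀ y, timeHolonomy U h (0, y) = timeHolonomy V h (0, y) := fun y =>
    timeHolonomy_congr h 0 y fun j hj => hUV _ (Finset.mem_coe.2 (by
      rw [zero_add]; exact natCast_none_mem_union_even (n := m) (by omega) y))
  rw [ht x, ht (x + Pi.single i 1), zero_add,
    hUV _ (Finset.mem_coe.2 (natCast_some_mem_union_even (n := m) hh x i))]

/-- **★ TY (A1.3) at finite temperature — doubling a Wilson rectangle in the time direction.**  On `ℤ_{L_t} × (ℤ/L_s)^d` with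
`L_t = 2m + 2`, for a continuous unitary `ρ`, any real `J_E, J_M`, a spatial direction `i`, a site `x` and a height
`1 ≤ h ≤ L_t/2`:  `|∫ tr ρ(W_{h×1}) e^{-S}|² ≤ N · Z · Re ∫ tr ρ(W_{2h×1}) e^{-S}` (both rectangles based at time `0`; reflection
positivity in the plane `t = 0` containing the lower side, Cauchy–Schwarz for the family of matrix entries of the staple, the
closing link contributing `tr(U Uᴴ) = N`, and a time translation by `h`). [cite: TomboulisYaffe1985, App. I eq. (A1.3) (p. 338)] -/
theorem normSq_integral_trace_timeRect_le (hρu : ∀ g, ρ g ∈ Matrix.unitaryGroup (Fin N) ℂ) (hρ : Continuous ρ)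
    (JE JM : ℝ) (i : Fin d) (x : Fin d → ZMod L) {h : ℕ} (hh : h ≤ m + 1) :
    ‖∫ U, (ρ (timeRect U h i 0 x)).trace * (weight ρ JE JM U : ℂ) ∂haar d (2 * m + 2) L G‖ ^ 2 ≤
      N * (∫ U, weight ρ JE JM U ∂haar d (2 * m + 2) L G) *
        (∫ U, (ρ (timeRect U (2 * h) i 0 x)).trace * (weight ρ JE JM U : ℂ) ∂haar d (2 * m + 2) L G).re := by
  -- the two families: entries of the staple, entries of the closing link
  set F : Fin N × Fin N → Config d (2 * m + 2) L G → ℂ := fun ab U => ρ (timeStaple U h i 0 x) ab.1 ab.2 with hF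
  set E : Fin N × Fin N → Config d (2 * m + 2) L G → ℂ := fun ab U => ρ (U ((0, x), some i)) ab.1 ab.2 with hE
  have hstc : Continuous fun U : Config d (2 * m + 2) L G => ρ (timeStaple U h i 0 x) := by
    refine hρ.comp ?_
    unfold timeStaple
    exact ((continuous_timeHolonomy h _).mul (continuous_link _)).mul (continuous_timeHolonomy h _).inv
  have hFm : ∀ k, Measurable (F k) := fun k => (hstc.matrix_elem k.1 k.2).measurable
  have hEm : ∀ k, Measurable (E k) := fun k => ((hρ.comp (continuous_link _)).matrix_elem k.1 k.2).measurable
  have hFb : ∀ k U, ‖F k U‖ ≤ 1 := fun k U => entry_norm_bound_of_unitary (hρu _) _ _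
  have hEb : ∀ k U, ‖E k U‖ ≤ 1 := fun k U => entry_norm_bound_of_unitary (hρu _) _ _
  have hFd : ∀ k, DependsOn (F k) ((evenPos d m L ∪ ∅ ∪ evenShared d m L : Finset _) : Set _) := fun k U V hUV => by
    show ρ (timeStaple U h i 0 x) k.1 k.2 = ρ (timeStaple V h i 0 x) k.1 k.2
    rw [show timeStaple U h i 0 x = timeStaple V h i 0 x from dependsOn_timeStaple hh i x hUV]
  have hEd : ∀ k, DependsOn (E k) ((evenPos d m L ∪ ∅ ∪ evenShared d m L : Finset _) : Set _) := fun k U V hUV => by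
    show ρ (U ((0, x), some i)) k.1 k.2 = ρ (V ((0, x), some i)) k.1 k.2
    rw [hUV _ (Finset.mem_coe.2 (Finset.mem_union_right _ (mem_evenShared_zero x i)))]
  have hCS := time_osForm_normSq_le ρ hρu hρ JE JM F E hFm hEm hFb hEb hFd hEd
  -- identify the three forms
  have hw := continuous_weight (d := d) (L₀ := 2 * m + 2) (L := L) ρ hρ JE JM
  obtain ⟨Kw, hKw⟩ := exists_forall_norm_le_of_continuous (L := L) hw
  have hint : ∀ (f g : Fin N × Fin N → Config d (2 * m + 2) L G → ℂ), (∀ k, Measurable (f k)) → (∀ k, Measurable (g k)) →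
      (∀ k U, ‖f k U‖ ≤ 1) → (∀ k U, ‖g k U‖ ≤ 1) → ∀ k, Integrable (fun U => f k U * conj (g k (timeReflect U)) *
        (weight ρ JE JM U : ℂ)) (haar d (2 * m + 2) L G) := by
    intro f g hfm hgm hfb hgb k
    refine Integrable.of_bound (((hfm k).mul (Complex.continuous_conj.measurable.comp ((hgm k).comp
      continuous_timeReflect.measurable))).mul (Complex.measurable_ofReal.comp hw.measurable)).aestronglyMeasurable Kw
      (ae_of_all _ fun U => ?_)
    rw [norm_mul, norm_mul, Complex.norm_conj, Complex.norm_real]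
    calc ‖f k U‖ * ‖g k (timeReflect U)‖ * ‖weight ρ JE JM U‖ ≤ 1 * 1 * ‖weight ρ JE JM U‖ :=
          mul_le_mul_of_nonneg_right (mul_le_mul (hfb k U) (hgb k _) (norm_nonneg _) zero_le_one) (norm_nonneg _)
      _ ≤ Kw := by rw [one_mul, one_mul]; exact hKw U
  -- B(F, E) = ∫ tr W_h e^{-S}
  have hFE : ∑ k, ∫ U, F k U * conj (E k (timeReflect U)) * (weight ρ JE JM U : ℂ) ∂haar d (2 * m + 2) L G =
      ∫ U, (ρ (timeRect U h i 0 x)).trace * (weight ρ JE JM U : ℂ) ∂haar d (2 * m + 2) L G := by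
    rw [← integral_finsetSum _ fun k _ => hint F E hFm hEm hFb hEb k]
    refine integral_congr_ae (Eventually.of_forall fun U => ?_)
    dsimp only
    rw [trace_rep_timeRect_eq_sum ρ hρu, Finset.sum_mul, Fintype.sum_prod_type]
    refine Finset.sum_congr rfl fun a _ => ?_
    rw [Finset.sum_mul]
    refine Finset.sum_congr rfl fun b _ => ?_
    simp only [hF, hE, timeReflect_some, neg_zero]
  -- B(F, F) = ∫ tr W_{2h} e^{-S} (based at `-h`, then translated to `0`)
  have hFF : ∑ k, ∫ U, F k U * conj (F k (timeReflect U)) * (weight ρ JE JM U : ℂ) ∂haar d (2 * m + 2) L G =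
      ∫ U, (ρ (timeRect U (2 * h) i 0 x)).trace * (weight ρ JE JM U : ℂ) ∂haar d (2 * m + 2) L G := by
    rw [← integral_finsetSum _ fun k _ => hint F F hFm hFm hFb hFb k]
    rw [← integral_comp_timeTranslate_mul_weight ρ JE JM (-(h : ZMod (2 * m + 2)))
      (fun U => (ρ (timeRect U (2 * h) i 0 x)).trace)]
    refine integral_congr_ae (Eventually.of_forall fun U => ?_)
    dsimp only
    rw [timeRect_timeTranslate, zero_add, trace_rep_timeRect_two_mul ρ hρu, Finset.sum_mul, Fintype.sum_prod_type]
    refine Finset.sum_congr rfl fun a _ => ?_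
    rw [Finset.sum_mul]
  -- B(E, E) = N · Z
  have hEE : ∑ k, ∫ U, E k U * conj (E k (timeReflect U)) * (weight ρ JE JM U : ℂ) ∂haar d (2 * m + 2) L G =
      ((N * ∫ U, weight ρ JE JM U ∂haar d (2 * m + 2) L G : ℝ) : ℂ) := by
    rw [← integral_finsetSum _ fun k _ => hint E E hEm hEm hEb hEb k]
    push_cast
    rw [← integral_complex_ofReal, ← integral_const_mul]
    refine integral_congr_ae (Eventually.of_forall fun U => ?_)
    dsimp only
    rw [← Finset.sum_mul, Fintype.sum_prod_type]
    simp only [hE, timeReflect_some, neg_zero]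
    have hN := sum_sum_conj_mul_self_of_unitary (hρu (U ((0, x), some i)))
    rw [show (∑ a, ∑ b, ρ (U ((0, x), some i)) a b * conj (ρ (U ((0, x), some i)) a b)) = (N : ℂ) by
      rw [← hN]; exact Finset.sum_congr rfl fun a _ => Finset.sum_congr rfl fun b _ => mul_comm _ _]
  rw [hFE, hFF, hEE, Complex.ofReal_re] at hCS
  calc ‖∫ U, (ρ (timeRect U h i 0 x)).trace * (weight ρ JE JM U : ℂ) ∂haar d (2 * m + 2) L G‖ ^ 2
      ≤ (∫ U, (ρ (timeRect U (2 * h) i 0 x)).trace * (weight ρ JE JM U : ℂ) ∂haar d (2 * m + 2) L G).re *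
          (N * ∫ U, weight ρ JE JM U ∂haar d (2 * m + 2) L G) := hCS
    _ = _ := by ring

/-- The doubled rectangle has a non-negative (real) expectation: `0 ≤ Re ∫ tr ρ(W_{2h×1}) e^{-S}` for `h ≤ L_t/2` (it is the
value of the reflection form on the staple family). [cite: TomboulisYaffe1985, App. I eq. (A1.3) (p. 338)] -/
theorem integral_trace_timeRect_two_mul_re_nonneg (hρu : ∀ g, ρ g ∈ Matrix.unitaryGroup (Fin N) ℂ) (hρ : Continuous ρ)
    (JE JM : ℝ) (i : Fin d) (x : Fin d → ZMod L) {h : ℕ} (hh : h ≤ m + 1) :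
    0 ≤ (∫ U, (ρ (timeRect U (2 * h) i 0 x)).trace * (weight ρ JE JM U : ℂ) ∂haar d (2 * m + 2) L G).re := by
  set F : Fin N × Fin N → Config d (2 * m + 2) L G → ℂ := fun ab U => ρ (timeStaple U h i 0 x) ab.1 ab.2 with hF
  have hstc : Continuous fun U : Config d (2 * m + 2) L G => ρ (timeStaple U h i 0 x) := by
    refine hρ.comp ?_
    unfold timeStaple
    exact ((continuous_timeHolonomy h _).mul (continuous_link _)).mul (continuous_timeHolonomy h _).inv
  have hFm : ∀ k, Measurable (F k) := fun k => (hstc.matrix_elem k.1 k.2).measurable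
  have hFb : ∀ k U, ‖F k U‖ ≤ 1 := fun k U => entry_norm_bound_of_unitary (hρu _) _ _
  have hFd : ∀ k, DependsOn (F k) ((evenPos d m L ∪ ∅ ∪ evenShared d m L : Finset _) : Set _) := fun k U V hUV => by
    show ρ (timeStaple U h i 0 x) k.1 k.2 = ρ (timeStaple V h i 0 x) k.1 k.2
    rw [show timeStaple U h i 0 x = timeStaple V h i 0 x from dependsOn_timeStaple hh i x hUV]
  have hpos := time_osForm_self_nonneg ρ hρu hρ JE JM F hFm hFb hFd
  have hw := continuous_weight (d := d) (L₀ := 2 * m + 2) (L := L) ρ hρ JE JM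
  obtain ⟨Kw, hKw⟩ := exists_forall_norm_le_of_continuous (L := L) hw
  have hint : ∀ k, Integrable (fun U => F k U * conj (F k (timeReflect U)) * (weight ρ JE JM U : ℂ))
      (haar d (2 * m + 2) L G) := by
    intro k
    refine Integrable.of_bound (((hFm k).mul (Complex.continuous_conj.measurable.comp ((hFm k).comp
      continuous_timeReflect.measurable))).mul (Complex.measurable_ofReal.comp hw.measurable)).aestronglyMeasurable Kw
      (ae_of_all _ fun U => ?_)
    rw [norm_mul, norm_mul, Complex.norm_conj, Complex.norm_real]
    calc ‖F k U‖ * ‖F k (timeReflect U)‖ * ‖weight ρ JE JM U‖ ≤ 1 * 1 * ‖weight ρ JE JM U‖ :=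
          mul_le_mul_of_nonneg_right (mul_le_mul (hFb k U) (hFb k _) (norm_nonneg _) zero_le_one) (norm_nonneg _)
      _ ≤ Kw := by rw [one_mul, one_mul]; exact hKw U
  have hFF : ∑ k, ∫ U, F k U * conj (F k (timeReflect U)) * (weight ρ JE JM U : ℂ) ∂haar d (2 * m + 2) L G =
      ∫ U, (ρ (timeRect U (2 * h) i 0 x)).trace * (weight ρ JE JM U : ℂ) ∂haar d (2 * m + 2) L G := by
    rw [← integral_finsetSum _ fun k _ => hint k]
    rw [← integral_comp_timeTranslate_mul_weight ρ JE JM (-(h : ZMod (2 * m + 2)))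
      (fun U => (ρ (timeRect U (2 * h) i 0 x)).trace)]
    refine integral_congr_ae (Eventually.of_forall fun U => ?_)
    dsimp only
    rw [timeRect_timeTranslate, zero_add, trace_rep_timeRect_two_mul ρ hρu, Finset.sum_mul, Fintype.sum_prod_type]
    refine Finset.sum_congr rfl fun a _ => ?_
    rw [Finset.sum_mul]
  rw [hFF] at hpos
  exact (Complex.nonneg_iff.1 hpos).1

end Doubling

/-! ### (A1.6)–(A1.7): the rectangle of height `L_t/2` against the Polyakov-loop pair -/

section HalfHeight

variable {d m L : ℕ} [NeZero L] {G : Type*} [Group G] [TopologicalSpace G] [IsTopologicalGroup G]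
  [CompactSpace G] [MeasurableSpace G] [BorelSpace G] [SecondCountableTopology G] {N : ℕ}
variable (ρ : G →* Matrix (Fin N) (Fin N) ℂ)

omit [NeZero L] [TopologicalSpace G] [IsTopologicalGroup G] [CompactSpace G] [MeasurableSpace G] [BorelSpace G]
  [SecondCountableTopology G] in
/-- `tr(A T Xᴴ Yᴴ) = Σ_{a,e,b,c} A_{ab} conj(X_{ec}) T_{bc} conj(Y_{ae})` — the traced rectangle as a contraction of its
time-like legs `A, X` with its space-like legs `T, Y`. [cite: TomboulisYaffe1985, App. I (A1.6)–(A1.7)] -/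
theorem trace_mul_mul_star_mul_star_eq_sum (A T X Y : Matrix (Fin N) (Fin N) ℂ) :
    (A * T * star X * star Y).trace = ∑ a, ∑ c, ∑ b, ∑ e, A a b * T b e * conj (X c e) * conj (Y a c) := by
  simp only [Matrix.trace, Matrix.diag_apply, Matrix.mul_apply, Matrix.star_apply, Complex.star_def,
    Finset.sum_mul]
  refine Eq.trans ?_ (Finset.sum_congr rfl fun a _ => Finset.sum_congr rfl fun c _ => Finset.sum_comm)
  exact Finset.sum_congr rfl fun a _ => Finset.sum_congr rfl fun c _ => Finset.sum_congr rfl fun e _ =>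
    Finset.sum_congr rfl fun b _ => by ring

omit [NeZero L] [TopologicalSpace G] [IsTopologicalGroup G] [CompactSpace G] [MeasurableSpace G] [BorelSpace G]
  [SecondCountableTopology G] in
/-- `tr(A B) conj tr(X W) = Σ_{a,e,b,c} (A_{ab} conj X_{ec}) · conj(conj(B_{ba}) W_{ce})` (plumbing for the Polyakov pair).
[cite: TomboulisYaffe1985, App. I (A1.6)–(A1.7)] -/
theorem trace_mul_mul_conj_trace_mul_eq_sum (A B X W : Matrix (Fin N) (Fin N) ℂ) :
    (A * B).trace * conj ((X * W).trace) =
      ∑ a, ∑ c, ∑ b, ∑ e, A a b * conj (X c e) * conj (conj (B b a) * W e c) := by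
  simp only [Matrix.trace, Matrix.diag_apply, Matrix.mul_apply, map_sum, map_mul, Complex.conj_conj]
  simp only [Finset.sum_mul]
  simp only [Finset.mul_sum]
  refine Eq.trans ?_ (Finset.sum_congr rfl fun a _ => Finset.sum_comm)
  exact Finset.sum_congr rfl fun a _ => Finset.sum_congr rfl fun b _ => Finset.sum_congr rfl fun c _ =>
    Finset.sum_congr rfl fun e _ => by ring

/-- **★ TY (A1.6)–(A1.7) at finite temperature — the rectangle of height `L_t/2` is bounded by the Polyakov-loop pair.**  On
`ℤ_{L_t} × (ℤ/L_s)^d` with `L_t = 2m + 2`, for a continuous unitary `ρ`, any real `J_E, J_M`, a spatial direction `i` and a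
site `x`:  `|∫ tr ρ(W_{(L_t/2)×1}) e^{-S}|² ≤ N² · Z · Re ∫ tr ρ(P_x) conj tr ρ(P_{x+e_i}) e^{-S}`, `P_y = g_{L_y}` the Polyakov
loop ("we may consider the spacelike legs of our loop to be on the opposite side of the planes of reflection from the timelike
legs and apply reflection positivity … Applying the Schwarz inequality for sums gives"; the family is indexed by the four matrix
indices of the contraction, the space-like legs contribute `N²`). [cite: TomboulisYaffe1985, App. I eqs. (A1.6)–(A1.7) (p. 339)] -/
theorem normSq_integral_trace_timeRect_half_le (hρu : ∀ g, ρ g ∈ Matrix.unitaryGroup (Fin N) ℂ) (hρ : Continuous ρ)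
    (JE JM : ℝ) (i : Fin d) (x : Fin d → ZMod L) :
    ‖∫ U, (ρ (timeRect U (m + 1) i 0 x)).trace * (weight ρ JE JM U : ℂ) ∂haar d (2 * m + 2) L G‖ ^ 2 ≤
      (N : ℝ) ^ 2 * (∫ U, weight ρ JE JM U ∂haar d (2 * m + 2) L G) *
        (∫ U, polyakovTrace ρ U x * conj (polyakovTrace ρ U (x + Pi.single i 1)) * (weight ρ JE JM U : ℂ)
          ∂haar d (2 * m + 2) L G).re := by
  set x' : Fin d → ZMod L := x + Pi.single i 1 with hx'
  set tH : ZMod (2 * m + 2) := ((m + 1 : ℕ) : ZMod (2 * m + 2)) with htH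
  -- the time-like legs and the space-like legs, indexed by `((a, e), (b, c))`
  set F : (Fin N × Fin N) × (Fin N × Fin N) → Config d (2 * m + 2) L G → ℂ := fun k U =>
    ρ (timeHolonomy U (m + 1) (0, x)) k.1.1 k.2.1 * conj (ρ (timeHolonomy U (m + 1) (0, x')) k.1.2 k.2.2) with hF
  set E : (Fin N × Fin N) × (Fin N × Fin N) → Config d (2 * m + 2) L G → ℂ := fun k U =>
    conj (ρ (U ((tH, x), some i)) k.2.1 k.2.2) * ρ (U ((0, x), some i)) k.1.1 k.1.2 with hE
  have hHc : ∀ y, Continuous fun U : Config d (2 * m + 2) L G => ρ (timeHolonomy U (m + 1) (0, y)) := fun y =>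
    hρ.comp (continuous_timeHolonomy (m + 1) _)
  have hFm : ∀ k, Measurable (F k) := fun k =>
    (((hHc x).matrix_elem _ _).mul (Complex.continuous_conj.comp ((hHc x').matrix_elem _ _))).measurable
  have hEm : ∀ k, Measurable (E k) := fun k =>
    ((Complex.continuous_conj.comp ((hρ.comp (continuous_link _)).matrix_elem _ _)).mul
      ((hρ.comp (continuous_link _)).matrix_elem _ _)).measurable
  have hFb : ∀ k U, ‖F k U‖ ≤ 1 := fun k U => by
    simp only [hF, norm_mul, Complex.norm_conj]
    exact mul_le_one₀ (entry_norm_bound_of_unitary (hρu _) _ _) (norm_nonneg _) (entry_norm_bound_of_unitary (hρu _) _ _)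
  have hEb : ∀ k U, ‖E k U‖ ≤ 1 := fun k U => by
    simp only [hE, norm_mul, Complex.norm_conj]
    exact mul_le_one₀ (entry_norm_bound_of_unitary (hρu _) _ _) (norm_nonneg _) (entry_norm_bound_of_unitary (hρu _) _ _)
  have hHd : ∀ y, DependsOn (fun U : Config d (2 * m + 2) L G => timeHolonomy U (m + 1) (0, y))
      ((evenPos d m L ∪ ∅ ∪ evenShared d m L : Finset _) : Set _) := fun y U V hUV =>
    timeHolonomy_congr (m + 1) 0 y fun j hj => hUV _ (Finset.mem_coe.2 (by
      rw [zero_add]; exact natCast_none_mem_union_even (n := m) (by omega) y))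
  have hFd : ∀ k, DependsOn (F k) ((evenPos d m L ∪ ∅ ∪ evenShared d m L : Finset _) : Set _) := fun k U V hUV => by
    show ρ (timeHolonomy U (m + 1) (0, x)) k.1.1 k.2.1 * conj (ρ (timeHolonomy U (m + 1) (0, x')) k.1.2 k.2.2) =
      ρ (timeHolonomy V (m + 1) (0, x)) k.1.1 k.2.1 * conj (ρ (timeHolonomy V (m + 1) (0, x')) k.1.2 k.2.2)
    rw [show timeHolonomy U (m + 1) (0, x) = timeHolonomy V (m + 1) (0, x) from hHd x hUV,
      show timeHolonomy U (m + 1) (0, x') = timeHolonomy V (m + 1) (0, x') from hHd x' hUV]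
  have hEd : ∀ k, DependsOn (E k) ((evenPos d m L ∪ ∅ ∪ evenShared d m L : Finset _) : Set _) := fun k U V hUV => by
    show conj (ρ (U ((tH, x), some i)) k.2.1 k.2.2) * ρ (U ((0, x), some i)) k.1.1 k.1.2 =
      conj (ρ (V ((tH, x), some i)) k.2.1 k.2.2) * ρ (V ((0, x), some i)) k.1.1 k.1.2
    rw [hUV _ (Finset.mem_coe.2 (Finset.mem_union_right _ (mem_evenShared_zero x i))),
      hUV _ (Finset.mem_coe.2 (Finset.mem_union_right _ (mem_evenShared_half x i)))]
  have hCS := time_osForm_normSq_le ρ hρu hρ JE JM F E hFm hEm hFb hEb hFd hEd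
  have hw := continuous_weight (d := d) (L₀ := 2 * m + 2) (L := L) ρ hρ JE JM
  obtain ⟨Kw, hKw⟩ := exists_forall_norm_le_of_continuous (L := L) hw
  have hint : ∀ (f g : (Fin N × Fin N) × (Fin N × Fin N) → Config d (2 * m + 2) L G → ℂ), (∀ k, Measurable (f k)) →
      (∀ k, Measurable (g k)) → (∀ k U, ‖f k U‖ ≤ 1) → (∀ k U, ‖g k U‖ ≤ 1) → ∀ k,
        Integrable (fun U => f k U * conj (g k (timeReflect U)) * (weight ρ JE JM U : ℂ)) (haar d (2 * m + 2) L G) := by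
    intro f g hfm hgm hfb hgb k
    refine Integrable.of_bound (((hfm k).mul (Complex.continuous_conj.measurable.comp ((hgm k).comp
      continuous_timeReflect.measurable))).mul (Complex.measurable_ofReal.comp hw.measurable)).aestronglyMeasurable Kw
      (ae_of_all _ fun U => ?_)
    rw [norm_mul, norm_mul, Complex.norm_conj, Complex.norm_real]
    calc ‖f k U‖ * ‖g k (timeReflect U)‖ * ‖weight ρ JE JM U‖ ≤ 1 * 1 * ‖weight ρ JE JM U‖ :=
          mul_le_mul_of_nonneg_right (mul_le_mul (hfb k U) (hgb k _) (norm_nonneg _) zero_le_one) (norm_nonneg _)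
      _ ≤ Kw := by rw [one_mul, one_mul]; exact hKw U
  -- the legs in the planes are fixed by the reflection
  have hEθ : ∀ k U, E k (timeReflect U) = E k U := fun k U => by
    simp only [hE, timeReflect_some, neg_zero, htH, neg_half]
  -- B(F, E) = ∫ tr W e^{-S}
  have hFE : ∑ k, ∫ U, F k U * conj (E k (timeReflect U)) * (weight ρ JE JM U : ℂ) ∂haar d (2 * m + 2) L G =
      ∫ U, (ρ (timeRect U (m + 1) i 0 x)).trace * (weight ρ JE JM U : ℂ) ∂haar d (2 * m + 2) L G := by
    rw [← integral_finsetSum _ fun k _ => hint F E hFm hEm hFb hEb k]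
    refine integral_congr_ae (Eventually.of_forall fun U => ?_)
    dsimp only
    rw [← Finset.sum_mul]
    congr 1
    have htr : (ρ (timeRect U (m + 1) i 0 x)).trace =
        (ρ (timeHolonomy U (m + 1) (0, x)) * ρ (U ((tH, x), some i)) * star (ρ (timeHolonomy U (m + 1) (0, x'))) *
          star (ρ (U ((0, x), some i)))).trace := by
      simp only [timeRect, timeStaple, map_mul, rep_inv_eq_star ρ hρu, zero_add, htH, hx']
    rw [htr, trace_mul_mul_star_mul_star_eq_sum, Fintype.sum_prod_type, Fintype.sum_prod_type]
    refine Finset.sum_congr rfl fun a _ => Finset.sum_congr rfl fun e _ => ?_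
    rw [Fintype.sum_prod_type]
    refine Finset.sum_congr rfl fun b _ => Finset.sum_congr rfl fun c _ => ?_
    rw [hEθ]
    simp only [hF, hE, map_mul, Complex.conj_conj]
    ring
  -- B(F, F) = ∫ tr P_x conj tr P_{x'} e^{-S}
  have hFF : ∑ k, ∫ U, F k U * conj (F k (timeReflect U)) * (weight ρ JE JM U : ℂ) ∂haar d (2 * m + 2) L G =
      ∫ U, polyakovTrace ρ U x * conj (polyakovTrace ρ U x') * (weight ρ JE JM U : ℂ) ∂haar d (2 * m + 2) L G := by
    rw [← integral_finsetSum _ fun k _ => hint F F hFm hFm hFb hFb k]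
    refine integral_congr_ae (Eventually.of_forall fun U => ?_)
    dsimp only
    rw [← Finset.sum_mul]
    congr 1
    have hθH : ∀ y, ρ (timeHolonomy (timeReflect U) (m + 1) (0, y)) = star (ρ (timeHolonomy U (m + 1) (tH, y))) := by
      intro y
      rw [timeHolonomy_timeReflect, rep_inv_eq_star ρ hρu, neg_zero, zero_sub, htH, neg_half]
    unfold polyakovTrace
    rw [polyakovLine_eq_mul_half U x, polyakovLine_eq_mul_half U x', map_mul, map_mul,
      trace_mul_mul_conj_trace_mul_eq_sum, Fintype.sum_prod_type, Fintype.sum_prod_type]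
    refine Finset.sum_congr rfl fun a _ => Finset.sum_congr rfl fun e _ => ?_
    rw [Fintype.sum_prod_type]
    refine Finset.sum_congr rfl fun b _ => Finset.sum_congr rfl fun c _ => ?_
    simp only [hF, hθH, map_mul, Matrix.star_apply, Complex.star_def, Complex.conj_conj, ← htH]
  -- B(E, E) = N² · Z
  have hEE : ∑ k, ∫ U, E k U * conj (E k (timeReflect U)) * (weight ρ JE JM U : ℂ) ∂haar d (2 * m + 2) L G =
      (((N : ℝ) ^ 2 * ∫ U, weight ρ JE JM U ∂haar d (2 * m + 2) L G : ℝ) : ℂ) := by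
    rw [← integral_finsetSum _ fun k _ => hint E E hEm hEm hEb hEb k]
    push_cast
    rw [← integral_complex_ofReal, ← integral_const_mul]
    refine integral_congr_ae (Eventually.of_forall fun U => ?_)
    dsimp only
    rw [← Finset.sum_mul]
    congr 1
    simp only [hEθ]
    have h1 := sum_sum_conj_mul_self_of_unitary (hρu (U ((tH, x), some i)))
    have h2 := sum_sum_conj_mul_self_of_unitary (hρu (U ((0, x), some i)))
    rw [Fintype.sum_prod_type]
    have hsplit : ∀ p : Fin N × Fin N, ∑ q : Fin N × Fin N, E (p, q) U * conj (E (p, q) U) =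
        (ρ (U ((0, x), some i)) p.1 p.2 * conj (ρ (U ((0, x), some i)) p.1 p.2)) *
          ∑ q : Fin N × Fin N, conj (ρ (U ((tH, x), some i)) q.1 q.2) * ρ (U ((tH, x), some i)) q.1 q.2 := by
      intro p
      rw [Finset.mul_sum]
      refine Finset.sum_congr rfl fun q _ => ?_
      simp only [hE, map_mul, Complex.conj_conj]
      ring
    simp_rw [hsplit]
    rw [← Finset.sum_mul, Fintype.sum_prod_type, Fintype.sum_prod_type, h1,
      show (∑ a, ∑ b, ρ (U ((0, x), some i)) a b * conj (ρ (U ((0, x), some i)) a b)) = (N : ℂ) by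
        rw [← h2]; exact Finset.sum_congr rfl fun a _ => Finset.sum_congr rfl fun b _ => mul_comm _ _]
    ring
  rw [hFE, hFF, hEE, Complex.ofReal_re] at hCS
  calc ‖∫ U, (ρ (timeRect U (m + 1) i 0 x)).trace * (weight ρ JE JM U : ℂ) ∂haar d (2 * m + 2) L G‖ ^ 2
      ≤ (∫ U, polyakovTrace ρ U x * conj (polyakovTrace ρ U x') * (weight ρ JE JM U : ℂ) ∂haar d (2 * m + 2) L G).re *
          ((N : ℝ) ^ 2 * ∫ U, weight ρ JE JM U ∂haar d (2 * m + 2) L G) := hCS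
    _ = _ := by ring

end HalfHeight

/-! ### §B: doubling the Polyakov-loop pair along a spatial axis -/

section PairDoubling

variable {d L₀ n : ℕ} [NeZero L₀] {G : Type*} [Group G] [TopologicalSpace G] [IsTopologicalGroup G]
  [CompactSpace G] [MeasurableSpace G] [BorelSpace G] [SecondCountableTopology G] {N : ℕ}
variable (ρ : G →* Matrix (Fin N) (Fin N) ℂ)

omit [TopologicalSpace G] [IsTopologicalGroup G] [CompactSpace G] [MeasurableSpace G] [BorelSpace G]
  [SecondCountableTopology G] in
/-- A Polyakov loop at a site with `x_i = -s`, `1 ≤ s ≤ n + 1`, depends only on the closed positive half of the site reflection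
in the direction `i` (`L = 2n + 2`). [cite: TomboulisYaffe1985, App. I §B (p. 339)] -/
theorem dependsOn_polyakovTrace_site (i : Fin d) {y : Fin d → ZMod (2 * n + 2)} {s : ℕ} (hs1 : 1 ≤ s) (hs : s ≤ n + 1)
    (hy : y i = -((s : ℕ) : ZMod (2 * n + 2))) :
    DependsOn (fun U : Config d L₀ (2 * n + 2) G => polyakovTrace ρ U y)
      ((sitePos d L₀ n i ∪ ∅ ∪ siteShared d L₀ n i : Finset _) : Set _) := by
  intro U V hUV
  simp only [polyakovTrace, polyakovLine]
  have hmem : ∀ j : ℕ, (((0 : ZMod L₀) + j, y), (none : Dir d)) ∈ sitePos d L₀ n i ∪ ∅ ∪ siteShared d L₀ n i := by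
    intro j
    rcases Nat.lt_or_ge s (n + 1) with hlt | hge
    · refine Finset.mem_union_left _ (Finset.mem_union_left _ (mem_sitePos_of_val ?_ ?_))
      · change 1 ≤ (-(y i)).val
        rw [hy, neg_neg, ZMod.val_cast_of_lt (by omega)]; exact hs1
      · change (-(y i)).val ≤ n
        rw [hy, neg_neg, ZMod.val_cast_of_lt (by omega)]; omega
    · have hsn : s = n + 1 := le_antisymm hs hge
      refine Finset.mem_union_right _ (mem_siteShared_of (by simp) (Or.inr ?_))
      change y i = _
      rw [hy, hsn, neg_half]
  rw [timeHolonomy_congr L₀ 0 y fun j hj => hUV _ (Finset.mem_coe.2 (hmem j))]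

omit [TopologicalSpace G] [IsTopologicalGroup G] [CompactSpace G] [MeasurableSpace G] [BorelSpace G]
  [SecondCountableTopology G] in
/-- A Polyakov loop in the reflection plane `x_i = 0` depends only on the closed positive half. [cite: TomboulisYaffe1985, App. I §B (p. 339)] -/
theorem dependsOn_polyakovTrace_plane (i : Fin d) {x : Fin d → ZMod (2 * n + 2)} (hx : x i = 0) :
    DependsOn (fun U : Config d L₀ (2 * n + 2) G => polyakovTrace ρ U x)
      ((sitePos d L₀ n i ∪ ∅ ∪ siteShared d L₀ n i : Finset _) : Set _) := by
  intro U V hUV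
  simp only [polyakovTrace, polyakovLine]
  have hmem : ∀ j : ℕ, (((0 : ZMod L₀) + j, x), (none : Dir d)) ∈ sitePos d L₀ n i ∪ ∅ ∪ siteShared d L₀ n i :=
    fun j => Finset.mem_union_right _ (mem_siteShared_of (by simp) (Or.inl hx))
  rw [timeHolonomy_congr L₀ 0 x fun j hj => hUV _ (Finset.mem_coe.2 (hmem j))]

omit [NeZero L₀] [TopologicalSpace G] [IsTopologicalGroup G] [CompactSpace G] [MeasurableSpace G] [BorelSpace G]
  [SecondCountableTopology G] in
/-- The site reflection in the plane `x_i = 0` fixes the sites of the plane and carries `x - s e_i` to `x + s e_i`.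
[cite: TomboulisYaffe1985, App. I §B (p. 339)] -/
theorem siteRefl_sub_single {L : ℕ} (i : Fin d) {x : Fin d → ZMod L} (hx : x i = 0) (c : ZMod L) :
    siteRefl i (x - Pi.single i c) = x + Pi.single i c := by
  funext j
  by_cases hj : j = i
  · subst hj; simp [hx]
  · simp [hj]

/-- **★ TY App. I §B at finite temperature — doubling the Polyakov-loop pair along a spatial axis.**  On
`ℤ_{L_t} × (ℤ/L_s)^d` with `L_s = 2n + 2 ≥ 4`, for a continuous unitary `ρ`, any real `J_E, J_M`, a direction `i`, a site `x`
of the lattice plane `x_i = 0` and a separation `1 ≤ s ≤ n + 1`: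
`|∫ tr ρ(P_x) conj tr ρ(P_{x - s e_i}) e^{-S}|² ≤ N² · Z · Re ∫ tr ρ(P_{x + s e_i}) conj tr ρ(P_{x - s e_i}) e^{-S}` and the right-hand
real part is `≥ 0` ("exactly the same procedure of successively applying various reflections … may be applied to the two point
function (A1.5) to show that `(G_J)^{1/J}` is monotonically increasing"; reflection positivity in the lattice plane `x_i = 0`).
[cite: TomboulisYaffe1985, App. I §B (p. 339)] -/
theorem normSq_integral_polyakov_pair_le (hρu : ∀ g, ρ g ∈ Matrix.unitaryGroup (Fin N) ℂ) (hρ : Continuous ρ) (hn : 1 ≤ n)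
    (JE JM : ℝ) (i : Fin d) {x : Fin d → ZMod (2 * n + 2)} (hx : x i = 0) {s : ℕ} (hs1 : 1 ≤ s) (hs : s ≤ n + 1) :
    ‖∫ U, polyakovTrace ρ U x * conj (polyakovTrace ρ U (x - Pi.single i (s : ZMod (2 * n + 2)))) *
        (weight ρ JE JM U : ℂ) ∂haar d L₀ (2 * n + 2) G‖ ^ 2 ≤
      (N : ℝ) ^ 2 * (∫ U, weight ρ JE JM U ∂haar d L₀ (2 * n + 2) G) *
        (∫ U, polyakovTrace ρ U (x + Pi.single i (s : ZMod (2 * n + 2))) *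
          conj (polyakovTrace ρ U (x - Pi.single i (s : ZMod (2 * n + 2)))) * (weight ρ JE JM U : ℂ)
            ∂haar d L₀ (2 * n + 2) G).re ∧
    0 ≤ (∫ U, polyakovTrace ρ U (x + Pi.single i (s : ZMod (2 * n + 2))) *
          conj (polyakovTrace ρ U (x - Pi.single i (s : ZMod (2 * n + 2)))) * (weight ρ JE JM U : ℂ)
            ∂haar d L₀ (2 * n + 2) G).re := by
  set xm : Fin d → ZMod (2 * n + 2) := x - Pi.single i (s : ZMod (2 * n + 2)) with hxm
  set xp : Fin d → ZMod (2 * n + 2) := x + Pi.single i (s : ZMod (2 * n + 2)) with hxp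
  have hxmi : xm i = -((s : ℕ) : ZMod (2 * n + 2)) := by simp [hxm, hx]
  have hrefl_m : siteRefl i xm = xp := siteRefl_sub_single i hx _
  have hrefl_x : siteRefl i x = x := by
    funext j; by_cases hj : j = i
    · subst hj; simp [hx]
    · simp [hj]
  set F : Unit → Config d L₀ (2 * n + 2) G → ℂ := fun _ U => conj (polyakovTrace ρ U xm) with hF
  set E : Unit → Config d L₀ (2 * n + 2) G → ℂ := fun _ U => conj (polyakovTrace ρ U x) with hE
  have hFm : ∀ k, Measurable (F k) := fun _ => (Complex.continuous_conj.comp (continuous_polyakovTrace ρ hρ _)).measurable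
  have hEm : ∀ k, Measurable (E k) := fun _ => (Complex.continuous_conj.comp (continuous_polyakovTrace ρ hρ _)).measurable
  have hFb : ∀ k U, ‖F k U‖ ≤ N := fun _ U => by
    rw [hF, Complex.norm_conj]; exact norm_trace_le_of_mem_unitaryGroup (hρu _)
  have hEb : ∀ k U, ‖E k U‖ ≤ N := fun _ U => by
    rw [hE, Complex.norm_conj]; exact norm_trace_le_of_mem_unitaryGroup (hρu _)
  have hFd : ∀ k, DependsOn (F k) ((sitePos d L₀ n i ∪ ∅ ∪ siteShared d L₀ n i : Finset _) : Set _) :=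
    fun _ U V hUV => by
      show conj (polyakovTrace ρ U xm) = conj (polyakovTrace ρ V xm)
      rw [show polyakovTrace ρ U xm = polyakovTrace ρ V xm from dependsOn_polyakovTrace_site ρ i hs1 hs hxmi hUV]
  have hEd : ∀ k, DependsOn (E k) ((sitePos d L₀ n i ∪ ∅ ∪ siteShared d L₀ n i : Finset _) : Set _) :=
    fun _ U V hUV => by
      show conj (polyakovTrace ρ U x) = conj (polyakovTrace ρ V x)
      rw [show polyakovTrace ρ U x = polyakovTrace ρ V x from dependsOn_polyakovTrace_plane ρ i hx hUV]
  have hCS := site_osForm_normSq_le ρ hρu hρ hn JE JM i F E hFm hEm hFb hEb hFd hEd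
  have hpos := site_osForm_self_nonneg ρ hρu hρ hn JE JM i F hFm hFb hFd
  -- identify the forms
  have hσF : ∀ U, F () (spaceSiteReflect i U) = conj (polyakovTrace ρ U xp) := fun U => by
    simp only [hF, polyakovTrace_spaceSiteReflect, hrefl_m]
  have hσE : ∀ U, E () (spaceSiteReflect i U) = conj (polyakovTrace ρ U x) := fun U => by
    simp only [hE, polyakovTrace_spaceSiteReflect, hrefl_x]
  have hFE : ∑ k, ∫ U, F k U * conj (E k (spaceSiteReflect i U)) * (weight ρ JE JM U : ℂ) ∂haar d L₀ (2 * n + 2) G =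
      ∫ U, polyakovTrace ρ U x * conj (polyakovTrace ρ U xm) * (weight ρ JE JM U : ℂ) ∂haar d L₀ (2 * n + 2) G := by
    rw [Fintype.sum_unique]
    refine integral_congr_ae (Eventually.of_forall fun U => ?_)
    dsimp only
    change F () U * conj (E () (spaceSiteReflect i U)) * _ = _
    rw [hσE]; simp only [hF, Complex.conj_conj]; ring
  have hFF : ∑ k, ∫ U, F k U * conj (F k (spaceSiteReflect i U)) * (weight ρ JE JM U : ℂ) ∂haar d L₀ (2 * n + 2) G =
      ∫ U, polyakovTrace ρ U xp * conj (polyakovTrace ρ U xm) * (weight ρ JE JM U : ℂ) ∂haar d L₀ (2 * n + 2) G := by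
    rw [Fintype.sum_unique]
    refine integral_congr_ae (Eventually.of_forall fun U => ?_)
    dsimp only
    change F () U * conj (F () (spaceSiteReflect i U)) * _ = _
    rw [hσF]; simp only [hF, Complex.conj_conj]; ring
  -- `B(E, E) ≤ N² Z`
  have hw := continuous_weight (d := d) (L₀ := L₀) (L := 2 * n + 2) ρ hρ JE JM
  have hEE : (∑ k, ∫ U, E k U * conj (E k (spaceSiteReflect i U)) * (weight ρ JE JM U : ℂ) ∂haar d L₀ (2 * n + 2) G).re ≤
      (N : ℝ) ^ 2 * ∫ U, weight ρ JE JM U ∂haar d L₀ (2 * n + 2) G := by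
    rw [Fintype.sum_unique]
    have hpt : ∀ U, E () U * conj (E () (spaceSiteReflect i U)) * (weight ρ JE JM U : ℂ) =
        ((‖polyakovTrace ρ U x‖ ^ 2 * weight ρ JE JM U : ℝ) : ℂ) := by
      intro U
      rw [hσE]
      simp only [hE, Complex.conj_conj]
      rw [mul_comm (conj _) _, Complex.mul_conj, Complex.normSq_eq_norm_sq]
      push_cast; ring
    simp_rw [hpt]
    rw [integral_complex_ofReal, Complex.ofReal_re, ← integral_const_mul]
    refine integral_mono_of_nonneg (Eventually.of_forall fun U => mul_nonneg (sq_nonneg _) (weight_pos ρ JE JM U).le)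
      ((integrable_of_continuous hw).const_mul _) (Eventually.of_forall fun U => ?_)
    exact mul_le_mul_of_nonneg_right (pow_le_pow_left₀ (norm_nonneg _) (norm_trace_le_of_mem_unitaryGroup (hρu _)) 2)
      (weight_pos ρ JE JM U).le
  rw [hFE, hFF] at hCS
  rw [hFF] at hpos
  have hre : 0 ≤ (∫ U, polyakovTrace ρ U xp * conj (polyakovTrace ρ U xm) * (weight ρ JE JM U : ℂ)
      ∂haar d L₀ (2 * n + 2) G).re := (Complex.nonneg_iff.1 hpos).1
  refine ⟨hCS.trans ?_, hre⟩
  calc (∫ U, polyakovTrace ρ U xp * conj (polyakovTrace ρ U xm) * (weight ρ JE JM U : ℂ) ∂haar d L₀ (2 * n + 2) G).re *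
        (∑ k, ∫ U, E k U * conj (E k (spaceSiteReflect i U)) * (weight ρ JE JM U : ℂ) ∂haar d L₀ (2 * n + 2) G).re
      ≤ (∫ U, polyakovTrace ρ U xp * conj (polyakovTrace ρ U xm) * (weight ρ JE JM U : ℂ) ∂haar d L₀ (2 * n + 2) G).re *
          ((N : ℝ) ^ 2 * ∫ U, weight ρ JE JM U ∂haar d L₀ (2 * n + 2) G) := mul_le_mul_of_nonneg_left hEE hre
    _ = _ := by ring

end PairDoubling

end FiniteTemperature

end Literature.Barriers.QuantumFields

end
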